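import Literature.MathematicalPhysics.QuantumFieldTheory.Balaban1983to89.B9Eq3124GaugeModes
import Literature.MathematicalPhysics.QuantumFieldTheory.Balaban1983to89.B9Eq324DeltaPrimeATower
import Literature.MathematicalPhysics.QuantumFieldTheory.Balaban1983to89.B9Eq3115QkGaugeModeTower
import Literature.MathematicalPhysics.QuantumFieldTheory.Balaban1983to89.B9Eq326OperatorTower

/-!
# `Balaban1983to89.B9Eq3152BareHessianGaugeModeTower` — T. Bałaban, *Propagators for lattice gauge theories in a background field*, Commun. Math. Phys.
# **99** (1985) 389–434 [Balaban1985BackgroundPropagators] (3.152) p. 426 (*«G₁DR = DG′R»*), (3.26) p. 395, (3.21)–(3.25) p. 394, (3.115) p. 418, (3.130)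
# p. 421 (*«Let us denote for a moment the operator we have investigated in previous sections by G₀, i.e. G₀ = (Δ + DRD* + Q*aQ)⁻¹»*): **PRINT's GAUGE-MODE
# IDENTITY (3.152) FOR THE BARE-HESSIAN PROPAGATOR `G₀ = G1k` OF THE `k`-TH STEP, WITH ITS DEFECT DISPLAYED — `G₀(D_U(R_kμ)) = D_Un′ − G₀(Δ^η(U)(D_Un′))`,
# `n′ := G′_k(R_kμ) ∈ N(Q′_k(U))`, `D*_UD_Un′ = R_kμ`** — the tower instances of the hypotheses (h2)∕(h3) of the `G₀ ↦ G̃` transfer (the NE9 owner's plan v14,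
# journal `HOME/CLAIMS.log` l.65765–65766; ne9-leaf-05 g87 R-9 §2 ∕ g88 C-leaf05-g88-1 l.65943 (iii); ne9-leaf-03 g79 `MEMO-3130-SOURCE-SIDE-g79.md` §3 (i))

statement-level skeleton of published theorems with citation tags; proofs where landed; nothing here is a claim about the Yang–Mills mass gap

CITATION HEADER (lean-in-tree rule).  Audit cell `pub-balaban`, sub-cell `t4`, BINDER row NE9; filed by NE9 crux-team LEAF PROVER 03
(`b2b-balaban-t4-ne9-formalise-leaf-03`, gen 80; road ΔA-CT).  Composed BY NAME, nothing restated: the abstract frame of ne9-leaf-01's `B9Eq3124GaugeModes` §2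
(`laplaceAK_gaugeMode` ∕ `G1K_gaugeMode` — there WITH the hypothesis (g1) «the Hessian kills the gauge modes», which holds for print's projected `Δ_π` and FAILS for
the bare `Δ^η(U)`; here the same bookkeeping WITHOUT (g1), the Hessian term carried on the right-hand side); at the tower: the owner's `B9Eq326OperatorTower`
(`laplaceAk`, `G1k`, `RofUk`, `QkW`, `QprimeTowerW`), `B9Eq324DeltaPrimeATower.GpOfUk_gaugeMode` ((g5) `Q′_kλ = 0 → G′_k(Δ_Uλ) = λ`), `B11Eq103H1Complex`
(`RLatticeK = projR (D*D) Q′`, `exists_ker_projR_eq`, `RLatticeK_apply_of_ker`, `greenK_apply`), ne9-leaf-02's (3.115) letter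
`B9Eq3115QkGaugeModeTower.QkW_covDerivL2K_eq_zero_of_QprimeTowerW_eq_zero`.  Source READ first-hand this generation (`paper:balaban1985-cmp99-background-propagators`,
journal page = PDF page + 388): p. 394 (3.21)–(3.25), p. 395 (3.26), p. 418 (3.115), p. 421 (3.130), pp. 425–426 (3.147)–(3.152).

THE PRINT (verbatim).  p. 426: *«… hence (3.151) gives RD*G₁ = RG′D*, and G₁DR = DG′R. (3.152)»* — for the propagator `G₁` whose Hessian slot is the
gauge-invariant extension `Δ_π` ((3.119), (3.122), (3.128)), which annihilates the gauge modes `Dλ`, `λ ∈ N(Q′)`.  p. 421: *«G₀ = (Δ + DRD* + Q*aQ)⁻¹»* — the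
bare Hessian `Δ = Δ^η(U)` of (3.10) does NOT annihilate them ((3.117): `⟨A, Δ(Dλ)⟩` is the current term).  WHAT THIS FILE RECORDS is the one-line
consequence of (3.26) + (3.21) + (3.115) + (3.24)–(3.25) that replaces (3.152) for `G₀`: on a gauge mode `D_Un′` with `Q′_kn′ = 0` the operator (3.26) acts as
`Δ_a(D_Un′) = Δ^η(U)(D_Un′) + D_U(D*_UD_Un′)` (the averaging term vanishes by (3.115), the projection `R_k` fixes `D*_UD_Un′ = Δ_Un′ ∈ Δ_U N(Q′_k)`), and every
`R_kμ` is such a `Δ_Un′` with `n′ = G′_k(R_kμ)`.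

WHY THIS FILE (cell context).  The NE9 owner's plan v14 (A-3 ∕ E-2, 2026-08-25) transfers the landed one-sided sup letters of `G₀ = G1k` ((K64) value, (DGK)
divergence, (E2) slice gradients) to print's `G̃_k = (Δ̃_{a,k})⁻¹` (`B9Eq3119DeltaPiTower.laplaceAkPi`) by a bootstrap on the resolvent identity
`G̃ = G₀ − G₀(Δ̃_{a,k} − Δ_{a,k})G̃` in ne9-leaf-05's (K71) `B9Eq3130NeumannLetter` frame; the factor `G₀∘D_U∘R_k` that the perturbation
`−E†H − HE + E†HE` (`E = D_UG′_kR_kD*_U`) puts in front of every site field is evaluated through THIS identity — (h2) `G₀(D(Rs)) = D(G′(Rs)) − G₀(M(G′(Rs)))`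
with `M := Δ^η(U)∘D_U` the gauge-mode stencil ((3.117); ne9-leaf-05's (K73)) and (h3) `D*D(G′(Rs)) = Rs` of the abstract pair-transfer file (K72) — so that only
RANGE rows of `G₀` and the value∕gradient rows of `G′_k` are ever needed, no source row (ne9-leaf-03 g80 W-1 ∕ A-1, journal l.65985 ∕ l.65994).

WHAT IS PROVED (sorry-free; proof lane — no `def`, no `Prop` placeholder; [folklore] linear algebra BY NAME).
* §1 (abstract `RCLike` Hilbert level, `B9Eq3124GaugeModes`' letters `Δ D R D* Q Q† a`, a set `N` of gauge parameters with (g2) `Q(Dl) = 0`, (g3) `R(D*(Dl)) = D*(Dl)`):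
  **`laplaceAK_gaugeMode_bare`** `Δ_{1,a}(Dl) = Δ(Dl) + D(D*(Dl))`; **`G1K_gaugeMode_bare`** `G₁(D(D*(Dl))) = Dl − G₁(Δ(Dl))`; with (g4) `∀ s, ∃ l ∈ N, Rs = D*(Dl)`:
  **`exists_G1K_D_R_bare`** `∃ l ∈ N, Rs = D*(Dl) ∧ G₁(D(Rs)) = Dl − G₁(Δ(Dl))`.
* §2 (the tower `T_{L^{n+1}m} → ⋯ → T_m`, the owner's letters; `n′ := G′_k(R_kμ)`): **`QprimeTowerW_GpOfUk_RofUk`** `Q′_k(U)n′ = 0`;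
  **`covLaplaceSiteK_GpOfUk_RofUk`** `D*_UD_Un′ = R_kμ` [(h3)]; **`RofUk_covLaplaceSiteK_GpOfUk_RofUk`** `R_k(D*_UD_Un′) = D*_UD_Un′`;
  **`laplaceAk_covDerivL2K_GpOfUk_RofUk`** `Δ_{a,k}(D_Un′) = Δ^η(U)(D_Un′) + D_U(R_kμ)`; **`G1k_covDerivL2K_RofUk`** `G₀(D_U(R_kμ)) = D_Un′ − G₀(Δ^η(U)(D_Un′))` [(h2),
  the Hessian term written both as `hessOp (covDerivL2K n′)` and, in **`G1k_covDerivL2K_RofUk'`**, as `(hessOp ∘ₗ covDerivL2K) n′` for an abstract-`M` consumer].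
HONEST SCOPE.  Pure algebra of the cell's own constructed objects; no estimate, no window, no constant; the positivity witnesses `hpos` (of `Δ_{a,k}`, [B9] Thm 3.11)
and `hpos′` (of `Δ′_{a′,k}`) DISPLAYED as everywhere in the chain; nothing of [B9] (3.117) ∕ (3.130)–(3.131) ∕ (3.152) ∕ Thm 3.3 is asserted, valued or discharged;
«NE9 ⇐ the named binders»; NE9 NOT PRINTED ∕ NOT PROVED; row WALLED ON A MODEL (O-NE9-1; #5 UNRULED); spine PROVED 0∕9; rung (B)+1 on a finite T⁴ — NOT infinite
volume, NOT mass gap, NOT BetaPertH, NOT Clay.  HONEST DEPENDENCY: continuum YM on T⁴ ⇐ BetaPertH ∧ nine spine estimates (0/9 proved); BetaPertH ⇐ (D1) ∧ (D4) ∧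
CAP+tail; G-an2-4 gates asym, D1 and NE2/3/4.  NEW file importing four BUILT modules; nothing modified.  Net new unproved facts: 0.
-/

noncomputable section

set_option autoImplicit false

open scoped InnerProductSpace ComplexConjugate BigOperators

namespace Literature.MathematicalPhysics.QuantumFieldTheory.Balaban1983to89.B9Eq3152BareHessianGaugeModeTower

open B11Eq103H1Complex

/-! ## §1 The bare gauge-mode identity at the abstract `RCLike` Hilbert level -/

section Abstract

variable {𝕜 : Type*} [RCLike 𝕜] {E : Type*} [NormedAddCommGroup E] [InnerProductSpace 𝕜 E]
  {F : Type*} [NormedAddCommGroup F] [InnerProductSpace 𝕜 F] {S : Type*} [AddCommGroup S] [Module 𝕜 S]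
  {Δ : E →ₗ[𝕜] E} {D : S →ₗ[𝕜] E} {R : S →ₗ[𝕜] S} {Dstar : E →ₗ[𝕜] S} {Q : E →ₗ[𝕜] F} {Qadj : F →ₗ[𝕜] E} {a : 𝕜}

/-- **`Δ_{1,a}(Dλ) = Δ(Dλ) + D(D*(Dλ))` ON A GAUGE MODE** with (g2) `Q(Dλ) = 0` and (g3) `R(D*(Dλ)) = D*(Dλ)` — `B9Eq3124GaugeModes.laplaceAK_gaugeMode`
WITHOUT its hypothesis (g1): the Hessian term is kept ([B9] (3.26) `Δ_a = Δ + DRD* + Q*aQ` at print's `G₀⁻¹`, p. 421). [folklore]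
[cite: Balaban1985BackgroundPropagators, (3.26) p.395, (3.130) p.421] -/
theorem laplaceAK_gaugeMode_bare (N : Set S) (g2 : ∀ l ∈ N, Q (D l) = 0) (g3 : ∀ l ∈ N, R (Dstar (D l)) = Dstar (D l)) {l : S} (hl : l ∈ N) :
    laplaceAK Δ D R Dstar Q Qadj a (D l) = Δ (D l) + D (Dstar (D l)) := by
  rw [laplaceAK_apply, g2 l hl, g3 l hl, smul_zero, map_zero, add_zero]

variable [FiniteDimensional 𝕜 E] (hpos : ∀ x : E, x ≠ 0 → 0 < RCLike.re ⟪x, laplaceAK Δ D R Dstar Q Qadj a x⟫_𝕜)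

/-- **`G₁(D(D*(Dλ))) = Dλ − G₁(Δ(Dλ))`** for such gauge modes — print's (3.152) `G₁DR = DG′R` for a Hessian slot that does NOT kill the gauge modes, the
defect `G₁(Δ(Dλ))` displayed. [folklore] [cite: Balaban1985BackgroundPropagators, (3.152) p.426, (3.130) p.421] -/
theorem G1K_gaugeMode_bare (N : Set S) (g2 : ∀ l ∈ N, Q (D l) = 0) (g3 : ∀ l ∈ N, R (Dstar (D l)) = Dstar (D l)) {l : S} (hl : l ∈ N) :
    G1K Δ D R Dstar Q Qadj a hpos (D (Dstar (D l))) = D l - G1K Δ D R Dstar Q Qadj a hpos (Δ (D l)) := by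
  have h : D (Dstar (D l)) = laplaceAK Δ D R Dstar Q Qadj a (D l) - Δ (D l) := by
    rw [laplaceAK_gaugeMode_bare (Qadj := Qadj) (a := a) N g2 g3 hl, add_sub_cancel_left]
  rw [h, map_sub, G1K_laplaceAK]

/-- **The `Rs` form**: with (g4) `∀ s, ∃ λ ∈ N, Rs = D*(Dλ)` (print's (3.21): `ℛ = Δ_U N(Q′)`), every `G₁(D(Rs))` is `Dλ − G₁(Δ(Dλ))` for a gauge parameter
`λ ∈ N` with `D*(Dλ) = Rs`. [folklore] [cite: Balaban1985BackgroundPropagators, (3.21) p.394, (3.152) p.426] -/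
theorem exists_G1K_D_R_bare (N : Set S) (g2 : ∀ l ∈ N, Q (D l) = 0) (g3 : ∀ l ∈ N, R (Dstar (D l)) = Dstar (D l))
    (g4 : ∀ s : S, ∃ l ∈ N, R s = Dstar (D l)) (s : S) :
    ∃ l ∈ N, R s = Dstar (D l) ∧ G1K Δ D R Dstar Q Qadj a hpos (D (R s)) = D l - G1K Δ D R Dstar Q Qadj a hpos (Δ (D l)) := by
  obtain ⟨l, hl, hs⟩ := g4 s
  exact ⟨l, hl, hs, by rw [hs, G1K_gaugeMode_bare hpos N g2 g3 hl]⟩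

end Abstract

/-! ## §2 The tower instances: `n′ = G′_k(R_kμ)` named, (h3) and (h2) -/

section Tower

open B4Sect5Torus (TSite)
open B9SectCLatticeCarrier (Bond)
open B7Prop1Explicit (U1 Wcx boxVec)
open B9Eq310HessianOperator (adTransportW hessOp)
open B9Eq315QTorus (perCfg cornerSite)
open B9Eq315QTower (towerP UlevOf)
open B9Eq326OperatorTower (QprimeTowerW QkW RofUk laplaceAk G1k)
open B9Eq324DeltaPrimeATower (laplacePrimeAk GpOfUk GpOfUk_gaugeMode)
open B9Eq3115QkGaugeModeTower (QkW_covDerivL2K_eq_zero_of_QprimeTowerW_eq_zero)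

variable {d : ℕ} (L : ℕ) [NeZero L] (m : Fin d → ℕ) [∀ i, NeZero (m i)] (n : ℕ)
  {𝔸 : Type*} [NormedRing 𝔸] [NormedAlgebra ℂ 𝔸] [CompleteSpace 𝔸] [NormOneClass 𝔸]
  {W : Type*} [NormedAddCommGroup W] [InnerProductSpace ℂ W] [FiniteDimensional ℂ W] (φ : W ≃ₗ[ℂ] 𝔸) {c₀ c₁ : ℝ} [Fact (0 < c₀)] [Fact (0 < c₁)]
  (η : ℝ) (U : Bond d (towerP L m (n + 1)) → 𝔸ˣ) (a' : ℝ)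
  (hpos' : ∀ x : SiteL2K ℂ d (towerP L m (n + 1)) c₀ W, x ≠ 0 → 0 < RCLike.re ⟪x, laplacePrimeAk L m n φ η U a' (c₁ := c₁) x⟫_ℂ)

omit [NormOneClass 𝔸] in
/-- **`n′ := G′_k(R_kμ)` LIES IN `N(Q′_k(U))`**: `R_kμ ∈ Δ_U N(Q′_k)` ((3.21)–(3.22), `exists_ker_projR_eq`), `R_kμ = Δ_Uλ₀` with `Q′_kλ₀ = 0`, and
`G′_k(Δ_Uλ₀) = λ₀` ((g5), `GpOfUk_gaugeMode`). [folklore] [cite: Balaban1985BackgroundPropagators, (3.21)–(3.22) p.394, (3.24)–(3.25) p.394] -/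
theorem QprimeTowerW_GpOfUk_RofUk (s : SiteL2K ℂ d (towerP L m (n + 1)) c₀ W) :
    QprimeTowerW L m n φ U (GpOfUk L m n φ η U a' hpos' (RofUk L m n φ η U s)) = 0 := by
  obtain ⟨l, hl, hs⟩ := exists_ker_projR_eq
    (covLaplaceSiteK ((η : ℂ))⁻¹ (adTransportW φ U) (adTransportW φ fun b => (U b)⁻¹)) (QprimeTowerW L m n φ U) s
  have hR : RofUk L m n φ η U (c₀ := c₀) s =
      covLaplaceSiteK ((η : ℂ))⁻¹ (adTransportW φ U) (adTransportW φ fun b => (U b)⁻¹) l := hs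
  rw [hR, GpOfUk_gaugeMode L m n φ η U a' hpos' l hl, hl]

omit [NormOneClass 𝔸] in
/-- **(h3) `D*_UD_U(G′_k(R_kμ)) = R_kμ`** — the covariant Laplacian (3.23) of `n′` returns `R_kμ` (same witness `λ₀`: `n′ = λ₀`, `Δ_Uλ₀ = R_kμ`).
[folklore] [cite: Balaban1985BackgroundPropagators, (3.21)–(3.23) p.394, (3.25) p.394] -/
theorem covLaplaceSiteK_GpOfUk_RofUk (s : SiteL2K ℂ d (towerP L m (n + 1)) c₀ W) :
    covLaplaceSiteK ((η : ℂ))⁻¹ (adTransportW φ U) (adTransportW φ fun b => (U b)⁻¹)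
        (GpOfUk L m n φ η U a' hpos' (RofUk L m n φ η U s)) = RofUk L m n φ η U s := by
  obtain ⟨l, hl, hs⟩ := exists_ker_projR_eq
    (covLaplaceSiteK ((η : ℂ))⁻¹ (adTransportW φ U) (adTransportW φ fun b => (U b)⁻¹)) (QprimeTowerW L m n φ U) s
  have hR : RofUk L m n φ η U (c₀ := c₀) s =
      covLaplaceSiteK ((η : ℂ))⁻¹ (adTransportW φ U) (adTransportW φ fun b => (U b)⁻¹) l := hs
  rw [hR, GpOfUk_gaugeMode L m n φ η U a' hpos' l hl]

omit [NormOneClass 𝔸] in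
/-- **`D*_UD_Un′` in operator form**: `covDivL2K (covDerivL2K n′) = R_kμ` ((3.23) `Δ_U = D*_UD_U` is `covLaplaceSiteK = covDivL2K ∘ₗ covDerivL2K` by definition).
[folklore] [cite: Balaban1985BackgroundPropagators, (3.23) p.394] -/
theorem covDivL2K_covDerivL2K_GpOfUk_RofUk (s : SiteL2K ℂ d (towerP L m (n + 1)) c₀ W) :
    covDivL2K ℂ c₀ ((η : ℂ))⁻¹ (adTransportW φ fun b => (U b)⁻¹)
        (covDerivL2K ℂ c₀ ((η : ℂ))⁻¹ (adTransportW φ U) (GpOfUk L m n φ η U a' hpos' (RofUk L m n φ η U s))) = RofUk L m n φ η U s :=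
  covLaplaceSiteK_GpOfUk_RofUk L m n φ η U a' hpos' s

omit [NormOneClass 𝔸] in
/-- **(g3) at `n′`: `R_k(D*_UD_Un′) = D*_UD_Un′`** ((3.21): `R_k` fixes `Δ_U N(Q′_k)`; `RLatticeK_apply_of_ker`). [folklore]
[cite: Balaban1985BackgroundPropagators, (3.21) p.394] -/
theorem RofUk_covLaplaceSiteK_GpOfUk_RofUk (s : SiteL2K ℂ d (towerP L m (n + 1)) c₀ W) :
    RofUk L m n φ η U (covDivL2K ℂ c₀ ((η : ℂ))⁻¹ (adTransportW φ fun b => (U b)⁻¹)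
        (covDerivL2K ℂ c₀ ((η : ℂ))⁻¹ (adTransportW φ U) (GpOfUk L m n φ η U a' hpos' (RofUk L m n φ η U s)))) =
      covDivL2K ℂ c₀ ((η : ℂ))⁻¹ (adTransportW φ fun b => (U b)⁻¹)
        (covDerivL2K ℂ c₀ ((η : ℂ))⁻¹ (adTransportW φ U) (GpOfUk L m n φ η U a' hpos' (RofUk L m n φ η U s))) :=
  RLatticeK_apply_of_ker _ _ _ _ (QprimeTowerW_GpOfUk_RofUk L m n φ η U a' hpos' s)

variable (hL : 1 ≤ L) (αU : ℕ → ℝ) (hα1 : ∀ j, αU j ≤ 1 / 64)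
  (hU1 : ∀ (j : ℕ) (x : B7Prop1Explicit.Site d) (κ : Fin d), perCfg (towerP L m (j + 1)) (UlevOf L m (n + 1) U j) x κ ∈ U1 𝔸)
  (hreg : ∀ (j : ℕ) (y : TSite d (towerP L m j)) (κ : Fin d) (r : Fin d → Fin L),
    ‖((Wcx L (perCfg (towerP L m (j + 1)) (UlevOf L m (n + 1) U j)) (cornerSite L y) κ (boxVec L r) : 𝔸ˣ) : 𝔸) - 1‖ ≤ αU j)
  [StarRing 𝔸] [StarModule ℂ 𝔸] (τ : 𝔸 →ₗ[ℂ] ℂ) (a : ℝ)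

/-- **(3.26) ON THE GAUGE MODE `D_Un′`: `Δ_{a,k}(U)(D_Un′) = Δ^η(U)(D_Un′) + D_U(R_kμ)`** — the averaging term vanishes by (3.115) (`Q_k(U)(D_Un′) = 0` since
`Q′_kn′ = 0`, ne9-leaf-02's `QkW_covDerivL2K_eq_zero_of_QprimeTowerW_eq_zero`), the projection term is `D_U(R_k(D*_UD_Un′)) = D_U(D*_UD_Un′) = D_U(R_kμ)`.
[folklore] [cite: Balaban1985BackgroundPropagators, (3.26) p.395, (3.115) p.418, (3.21) p.394] -/
theorem laplaceAk_covDerivL2K_GpOfUk_RofUk (s : SiteL2K ℂ d (towerP L m (n + 1)) c₀ W) :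
    laplaceAk L m n φ η U hL αU hα1 hU1 hreg τ (c₀ := c₀) (c₁ := c₁) a
        (covDerivL2K ℂ c₀ ((η : ℂ))⁻¹ (adTransportW φ U) (GpOfUk L m n φ η U a' hpos' (RofUk L m n φ η U s))) =
      hessOp φ η U τ (covDerivL2K ℂ c₀ ((η : ℂ))⁻¹ (adTransportW φ U) (GpOfUk L m n φ η U a' hpos' (RofUk L m n φ η U s))) +
        covDerivL2K ℂ c₀ ((η : ℂ))⁻¹ (adTransportW φ U) (RofUk L m n φ η U s) := by
  unfold laplaceAk B11Eq103H1Complex.laplaceALatticeK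
  rw [laplaceAK_apply, QkW_covDerivL2K_eq_zero_of_QprimeTowerW_eq_zero φ η L m n hL U αU hα1 hU1 hreg _
      (QprimeTowerW_GpOfUk_RofUk L m n φ η U a' hpos' s),
    smul_zero, map_zero, add_zero, RofUk_covLaplaceSiteK_GpOfUk_RofUk L m n φ η U a' hpos' s,
    covDivL2K_covDerivL2K_GpOfUk_RofUk L m n φ η U a' hpos' s]

variable (hpos : ∀ x : BondL2K ℂ d (towerP L m (n + 1)) c₀ W, x ≠ 0 →
    0 < RCLike.re ⟪x, laplaceAk L m n φ η U hL αU hα1 hU1 hreg τ (c₀ := c₀) (c₁ := c₁) a x⟫_ℂ)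

/-- `G₁(U)(Δ_{a,k}(U)f) = f` (finite dimension: the constructed right inverse is a left inverse, `greenK_apply`). [folklore]
[cite: Balaban1985BackgroundPropagators, Thm 3.11 p.416; Balaban1985Variational, (110) p.294] -/
private theorem G1k_laplaceAk_apply (f : BondL2K ℂ d (towerP L m (n + 1)) c₀ W) :
    G1k L m n φ η U hL αU hα1 hU1 hreg τ (c₀ := c₀) (c₁ := c₁) hpos (laplaceAk L m n φ η U hL αU hα1 hU1 hreg τ (c₀ := c₀) (c₁ := c₁) a f) = f := by
  unfold G1k B11Eq103H1Complex.G1LatticeK B11Eq103H1Complex.G1K laplaceAk B11Eq103H1Complex.laplaceALatticeK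
  rw [greenK_apply]

/-- **(h2) THE BARE (3.152) AT THE TOWER: `G₀(D_U(R_kμ)) = D_Un′ − G₀(Δ^η(U)(D_Un′))`, `n′ = G′_k(R_kμ)`** — apply `G₀ = G1k` to
`laplaceAk_covDerivL2K_GpOfUk_RofUk`.  With the (3.117) stencil `M = Δ^η(U)∘D_U` (ne9-leaf-05's (K73)) the right-hand side needs only the value∕gradient rows of
`G′_k` and the RANGE rows of `G₀`. [folklore] [cite: Balaban1985BackgroundPropagators, (3.152) p.426, (3.130) p.421, (3.26) p.395] -/
theorem G1k_covDerivL2K_RofUk (s : SiteL2K ℂ d (towerP L m (n + 1)) c₀ W) :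
    G1k L m n φ η U hL αU hα1 hU1 hreg τ (c₀ := c₀) (c₁ := c₁) hpos (covDerivL2K ℂ c₀ ((η : ℂ))⁻¹ (adTransportW φ U) (RofUk L m n φ η U s)) =
      covDerivL2K ℂ c₀ ((η : ℂ))⁻¹ (adTransportW φ U) (GpOfUk L m n φ η U a' hpos' (RofUk L m n φ η U s)) -
        G1k L m n φ η U hL αU hα1 hU1 hreg τ (c₀ := c₀) (c₁ := c₁) hpos
          (hessOp φ η U τ (covDerivL2K ℂ c₀ ((η : ℂ))⁻¹ (adTransportW φ U) (GpOfUk L m n φ η U a' hpos' (RofUk L m n φ η U s)))) := by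
  have h := laplaceAk_covDerivL2K_GpOfUk_RofUk L m n φ η U a' hpos' hL αU hα1 hU1 hreg τ a s
  have h' : covDerivL2K ℂ c₀ ((η : ℂ))⁻¹ (adTransportW φ U) (RofUk L m n φ η U s) =
      laplaceAk L m n φ η U hL αU hα1 hU1 hreg τ (c₀ := c₀) (c₁ := c₁) a
          (covDerivL2K ℂ c₀ ((η : ℂ))⁻¹ (adTransportW φ U) (GpOfUk L m n φ η U a' hpos' (RofUk L m n φ η U s))) -
        hessOp φ η U τ (covDerivL2K ℂ c₀ ((η : ℂ))⁻¹ (adTransportW φ U) (GpOfUk L m n φ η U a' hpos' (RofUk L m n φ η U s))) := by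
    rw [h, add_sub_cancel_left]
  rw [h', map_sub, G1k_laplaceAk_apply]

/-- **(h2) with the stencil as ONE operator `M := Δ^η(U) ∘ₗ D_U`** (sites → bonds) — the shape an abstract pair-transfer consumer instantiates.
[folklore] [cite: Balaban1985BackgroundPropagators, (3.152) p.426, (3.117) p.419] -/
theorem G1k_covDerivL2K_RofUk' (s : SiteL2K ℂ d (towerP L m (n + 1)) c₀ W) :
    G1k L m n φ η U hL αU hα1 hU1 hreg τ (c₀ := c₀) (c₁ := c₁) hpos (covDerivL2K ℂ c₀ ((η : ℂ))⁻¹ (adTransportW φ U) (RofUk L m n φ η U s)) =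
      covDerivL2K ℂ c₀ ((η : ℂ))⁻¹ (adTransportW φ U) (GpOfUk L m n φ η U a' hpos' (RofUk L m n φ η U s)) -
        G1k L m n φ η U hL αU hα1 hU1 hreg τ (c₀ := c₀) (c₁ := c₁) hpos
          ((hessOp φ η U τ ∘ₗ covDerivL2K ℂ c₀ ((η : ℂ))⁻¹ (adTransportW φ U)) (GpOfUk L m n φ η U a' hpos' (RofUk L m n φ η U s))) :=
  G1k_covDerivL2K_RofUk L m n φ η U a' hpos' hL αU hα1 hU1 hreg τ a hpos s

end Tower

end Literature.MathematicalPhysics.QuantumFieldTheory.Balaban1983to89.B9Eq3152BareHessianGaugeModeTower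

end
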